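import Literature.MathematicalPhysics.PowerSystems.RingNonNormalOperationInstability
import Literature.Analysis.ODE.LyapunovIndirectMethod
import HarnessLib

/-!
# Manik–Timme–Witthaut's Lemma 1, unstable clause, WITHOUT isolation or nondegeneracy: one negative
# direction of the Hesse form of the potential makes the rest point of the damped swing model
# UNSTABLE — through a real positive eigenvalue of the linearisation and Lyapunov's indirect method

Topic `Literature/MathematicalPhysics/PowerSystems`, namespace
`Literature.MathematicalPhysics.PowerSystems.ClassicalModel.LosslessSystem`. The tree had the unstable
clause of Lemma 1 in two conditional forms: with an ISOLATION/census hypothesis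
(`unstable_of_hessForm_neg`, energy route) and with transversal NONDEGENERACY of the Hesse matrix
(`unstable_rest_of_negativeDirection_of_nondegenerate`, `NondegenerateEquilibriumInstability`). Here
the printed statement itself: a negative direction suffices. ROUTE (the print's «linear stability
analysis»): a negative direction `vᵀM(θe)v < 0` of the (symmetric) Hesse matrix produces a REAL
POSITIVE EIGENVALUE `λ` of the swing Jacobian `[[0, 1], [−M⁻¹·Hess, −M⁻¹D]]` — the matrix pencil
`λ²·diag(M) + λ·diag(D) + Hess` is singular for some `λ > 0` (a variational/continuity argument on the
unit sphere) — and a real positive eigenvalue of the Jacobian makes the rest point of the NONLINEAR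
system unstable by Lyapunov's indirect method (Khalil Thm 4.7, part 2: lit-2's
`unstable_of_charpoly_root_re_pos`, which needs no hyperbolicity — «other eigenvalues may lie
anywhere, in particular on the imaginary axis (the rotation mode)»). Everything below is PROVED (no
definition, no named fact, no new axiom).

SOURCES (read on the page this session). D. Manik, M. Timme, D. Witthaut, Chaos 27 (2017) 083123
[ManikTimmeWitthaut2017] §3 **Lemma 1** (arXiv:1611.09825 p0004 L46–L55): «The linear stability of
the fixed point is determined by the eigenvalues of the Hesse matrix M … (transversally) asymptotically
stable if M is positive semi-definite … It is unstable if at least one eigenvalue of M is negative»;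
H. K. Khalil, *Nonlinear Systems* (3rd ed.) [Khalil2002] **Thm 4.7** (part 2: «the origin is unstable
if Re λᵢ > 0 for one or more of the eigenvalues of A»), as typed by gridfusion-lit-2 in
`Literature/Analysis/ODE/LyapunovIndirectMethod.lean`.

## What is proved

* §1 `quadPencil_*` plumbing and ★ **`exists_pos_pencil_root_of_negativeDirection`** (pure linear
  algebra, `Fin n`): for `Mᵢ > 0`, `Dᵢ ≥ 0`, a symmetric matrix `H` and a vector `v` with
  `vᵀHv < 0` there are `λ > 0` and `u ≠ 0` with `Hu + λ·D∘u + λ²·M∘u = 0` (so `t ↦ e^{λt}u` solves the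
  linearised swing equation `Mü + Dů + Hu = 0`).
* §2 `hasFDerivAt_field` (the Jacobian of the swing field at `(θ, ω)` as an explicit continuous
  linear map), ★★ **`unstable_rest_of_hessForm_neg`** (ANY number of infinite buses, `Mᵢ, Dᵢ > 0`,
  `C` symmetric, `θe` an equilibrium, ONE direction `v` with
  `½ΣᵢΣⱼCᵢⱼcos(θeᵢ − θeⱼ)(vᵢ − vⱼ)² + ΣᵢΣ_bKᵢb cos(θeᵢ − β_b)vᵢ² < 0` ⇒ the rest point `(θe, 0)` is
  UNSTABLE: `∃ ε > 0 ∀ δ > 0 ∃ x₁` within `δ` of `(θe, 0)` such that EVERY forward motion from `x₁`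
  leaves the `ε`-ball) — no isolation, no census, no nondegeneracy.
* §3 ★★ **`unstable_syncSolution_of_hessForm_neg`** (no infinite bus): the same for the synchronous
  SOLUTION `(θe + ω_s t𝟙, ω_s𝟙)` through a synchronous state (`Pₖ − Dₖω_s = flowₖ(θe)`,
  `ω_s = ΣP/ΣD`), by the rotating frame.
* §4 the tree's conditional unstable clauses WITHOUT their nondegeneracy hypothesis:
  `unstable_rest_of_negative_cut` / `unstable_syncSolution_of_negative_cut` (Taylor's cut lemma as
  an instability statement), `loadedRing_unstable_syncSolution_of_two_negative_lines'` (DCJ §4.3: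
  two negative-cosine lines on a loaded ring), ★★★ **`ringSystem_unstable_of_long_line`** (DCJ
  Thm 4.1 for EVERY `N ≥ 3`: a synchronous state of the unloaded homogeneous ring with a
  negative-cosine line is an unstable rest point — with `ring_normalOperation_census`, off the set
  `|θᵢ − θⱼ| = π/2` «stable ⇔ normal operation ⇔ twisted with 4|q| < N»).
* §5 (append) ★★★ **`ringSystem_stable_iff_normalOperation`**, ★★★ **`ringSystem_stable_iff_twisted`**:
  the ring dichotomy as ONE equivalence for every `N ≥ 3` — for a synchronous state with no line at
  `|Δθ| = π/2`, the rest point is Lyapunov stable (ε–δ, with existence of motions) iff every line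
  cosine is positive iff the state is a twisted state with `4|q| < N` up to rotation and turns.
* §6 (append) NECESSITY as printed («stable» = Lyapunov stable; motions exist, `exists_globalSolution`):
  ★★ `hessForm_nonneg_of_stable` (any buses: a stable equilibrium has a PSD Hesse form),
  ★★ `cut_nonneg_of_stable` (Taylor 2012 Lemma 2.1 verbatim), `hessForm_nonneg_of_stable_syncSolution`,
  `cut_nonneg_of_stable_syncSolution` (m = 0), ★★ `loadedRing_at_most_one_negative_line_of_stable` /
  `loadedRing_card_negative_lines_le_one_of_stable` (DCJ §4.3: a stable synchronous solution of a
  loaded ring has at most one line with `|Δθ| > π/2`).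

THREE COLUMNS. CERTIFIED for MODEL `M` = damped lossless network-reduced swing model, any topology,
any buses (MV-1 class): the printed unstable clause of Lemma 1 for the motions. NOT CLAIMED: the
stable clause beyond the tree's versions; anything about a power system.
-/

noncomputable section

open Real Set Filter Topology Metric Finset
open scoped Matrix

namespace Literature.MathematicalPhysics.PowerSystems

namespace ClassicalModel

/-! ### §1. A negative direction of a symmetric matrix gives a positive root of the quadratic pencil
`λ²·diag(M) + λ·diag(D) + H` -/

section Pencil

variable {n : ℕ}

/-- Homogeneity of the pencil's quadratic form. [folklore] -/
private theorem quadPencil_smul (M D : Fin n → ℝ) (H : Matrix (Fin n) (Fin n) ℝ) (l c : ℝ)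
    (u : Fin n → ℝ) :
    ∑ i, ((c * u i) * ∑ j, H i j * (c * u j) + (l ^ 2 * M i + l * D i) * (c * u i) ^ 2)
      = c ^ 2 * ∑ i, (u i * ∑ j, H i j * u j + (l ^ 2 * M i + l * D i) * u i ^ 2) := by
  rw [Finset.mul_sum]
  refine Finset.sum_congr rfl fun i _ => ?_
  have h : ∑ j, H i j * (c * u j) = c * ∑ j, H i j * u j := by
    rw [Finset.mul_sum]
    exact Finset.sum_congr rfl fun j _ => by ring
  rw [h]
  ring

/-- Expansion of the pencil's quadratic form along a line (`H` symmetric). [folklore] -/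
private theorem quadPencil_add_smul (M D : Fin n → ℝ) (H : Matrix (Fin n) (Fin n) ℝ)
    (hH : ∀ i j, H i j = H j i) (l t : ℝ) (u w : Fin n → ℝ) :
    ∑ i, ((u i + t * w i) * ∑ j, H i j * (u j + t * w j)
        + (l ^ 2 * M i + l * D i) * (u i + t * w i) ^ 2)
      = ∑ i, (u i * ∑ j, H i j * u j + (l ^ 2 * M i + l * D i) * u i ^ 2)
        + 2 * t * ∑ i, w i * ((∑ j, H i j * u j) + (l ^ 2 * M i + l * D i) * u i)
        + t ^ 2 * ∑ i, (w i * ∑ j, H i j * w j + (l ^ 2 * M i + l * D i) * w i ^ 2) := by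
  have inner : ∀ i, ∑ j, H i j * (u j + t * w j) = (∑ j, H i j * u j) + t * ∑ j, H i j * w j := by
    intro i
    rw [Finset.mul_sum, ← Finset.sum_add_distrib]
    exact Finset.sum_congr rfl fun j _ => by ring
  -- the symmetric cross term
  have hsym : ∑ i, u i * ∑ j, H i j * w j = ∑ i, w i * ∑ j, H i j * u j := by
    simp only [Finset.mul_sum]
    rw [Finset.sum_comm]
    refine Finset.sum_congr rfl fun i _ => Finset.sum_congr rfl fun j _ => ?_
    rw [hH j i]
    ring
  -- pointwise expansion with the inner sums as atoms
  have hpt : ∀ i, (u i + t * w i) * ((∑ j, H i j * u j) + t * ∑ j, H i j * w j)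
      + (l ^ 2 * M i + l * D i) * (u i + t * w i) ^ 2
      = (u i * ∑ j, H i j * u j + (l ^ 2 * M i + l * D i) * u i ^ 2)
        + (t * (w i * ∑ j, H i j * u j) + t * (u i * ∑ j, H i j * w j)
          + 2 * t * ((l ^ 2 * M i + l * D i) * u i * w i))
        + t ^ 2 * (w i * ∑ j, H i j * w j + (l ^ 2 * M i + l * D i) * w i ^ 2) := by
    intro i; ring
  have e1 : ∑ i, ((u i + t * w i) * ∑ j, H i j * (u j + t * w j)
      + (l ^ 2 * M i + l * D i) * (u i + t * w i) ^ 2)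
      = ∑ i, (u i * ∑ j, H i j * u j + (l ^ 2 * M i + l * D i) * u i ^ 2)
        + ((t * ∑ i, w i * ∑ j, H i j * u j) + (t * ∑ i, u i * ∑ j, H i j * w j)
          + 2 * t * ∑ i, (l ^ 2 * M i + l * D i) * u i * w i)
        + t ^ 2 * ∑ i, (w i * ∑ j, H i j * w j + (l ^ 2 * M i + l * D i) * w i ^ 2) := by
    rw [Finset.mul_sum Finset.univ (fun i => w i * ∑ j, H i j * u j) t,
      Finset.mul_sum Finset.univ (fun i => u i * ∑ j, H i j * w j) t,
      Finset.mul_sum Finset.univ (fun i => (l ^ 2 * M i + l * D i) * u i * w i) (2 * t),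
      Finset.mul_sum Finset.univ
        (fun i => w i * ∑ j, H i j * w j + (l ^ 2 * M i + l * D i) * w i ^ 2) (t ^ 2),
      ← Finset.sum_add_distrib, ← Finset.sum_add_distrib, ← Finset.sum_add_distrib,
      ← Finset.sum_add_distrib]
    refine Finset.sum_congr rfl fun i _ => ?_
    rw [inner i]
    exact hpt i
  rw [e1, hsym]
  have e2 : 2 * t * ∑ i, w i * ((∑ j, H i j * u j) + (l ^ 2 * M i + l * D i) * u i)
      = (t * ∑ i, w i * ∑ j, H i j * u j) + (t * ∑ i, w i * ∑ j, H i j * u j)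
        + 2 * t * ∑ i, (l ^ 2 * M i + l * D i) * u i * w i := by
    rw [Finset.mul_sum Finset.univ _ (2 * t), Finset.mul_sum Finset.univ _ t,
      Finset.mul_sum Finset.univ (fun i => (l ^ 2 * M i + l * D i) * u i * w i) (2 * t),
      ← Finset.sum_add_distrib, ← Finset.sum_add_distrib]
    exact Finset.sum_congr rfl fun i _ => by ring
  rw [e2]

/-- If `2tβ + t²γ ≥ 0` for every real `t` then `β = 0`. [folklore] -/
private theorem eq_zero_of_forall_quad_nonneg {β γ : ℝ} (h : ∀ t : ℝ, 0 ≤ 2 * t * β + t ^ 2 * γ) :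
    β = 0 := by
  by_contra hβ
  set a := |γ| + 1 with ha
  have ha0 : 0 < a := by positivity
  have h1 := h (-β / a)
  have key : 2 * (-β / a) * β + (-β / a) ^ 2 * γ = -(β ^ 2 / a ^ 2) * (2 * a - γ) := by
    field_simp
    ring
  rw [key] at h1
  have h2 : 0 < 2 * a - γ := by have := le_abs_self γ; linarith
  have h3 : 0 < β ^ 2 / a ^ 2 := by positivity
  nlinarith

/-- ★ **A negative direction gives a positive root of the pencil.** For `Mᵢ > 0`, `Dᵢ ≥ 0`, a
symmetric `H` and `v` with `Σᵢ vᵢ Σⱼ Hᵢⱼvⱼ < 0` there are `λ > 0` and `u ≠ 0` with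
`Σⱼ Hᵢⱼuⱼ + λDᵢuᵢ + λ²Mᵢuᵢ = 0` for every `i` — the linearised swing equation `Mü + Dů + Hu = 0` has
the growing mode `e^{λt}u`. PROOF: on the unit sphere the form `q_λ(u) = uᵀHu + Σ(λ²Mᵢ + λDᵢ)uᵢ²` is
negative somewhere at `λ = 0` and positive everywhere for `λ` large; the largest `λ` at which it still
has a non-positive value (a compactness supremum) makes `q_λ` positive semidefinite with a zero `u`,
and a zero of a positive semidefinite form is in the kernel.
[cite: ManikTimmeWitthaut2017, §3 Lemma 1 («linear stability … determined by the eigenvalues of the Hesse matrix … unstable if at least one eigenvalue of M is negative») and App. A] -/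
theorem exists_pos_pencil_root_of_negativeDirection (M D : Fin n → ℝ) (hM : ∀ i, 0 < M i)
    (hD : ∀ i, 0 ≤ D i) (H : Matrix (Fin n) (Fin n) ℝ) (hH : ∀ i j, H i j = H j i)
    (v : Fin n → ℝ) (hv : ∑ i, v i * ∑ j, H i j * v j < 0) :
    ∃ lam : ℝ, 0 < lam ∧ ∃ u : Fin n → ℝ, u ≠ 0 ∧
      ∀ i, (∑ j, H i j * u j) + lam * D i * u i + lam ^ 2 * M i * u i = 0 := by
  -- the pencil's quadratic form
  set q : ℝ → (Fin n → ℝ) → ℝ :=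
    fun l u => ∑ i, (u i * ∑ j, H i j * u j + (l ^ 2 * M i + l * D i) * u i ^ 2) with hq
  have hqc : Continuous fun p : ℝ × (Fin n → ℝ) => q p.1 p.2 := by
    simp only [hq]
    fun_prop
  -- `v ≠ 0`, so `Fin n` is nonempty and the unit sphere contains `v/‖v‖`
  have hv0 : v ≠ 0 := by
    rintro rfl
    simp at hv
  have hvn : 0 < ‖v‖ := norm_pos_iff.2 hv0
  set S : Set (Fin n → ℝ) := Metric.sphere 0 1 with hS
  have hScpt : IsCompact S := isCompact_sphere 0 1
  have hmemS : ∀ u, u ∈ S ↔ ‖u‖ = 1 := fun u => by rw [hS, mem_sphere_zero_iff_norm]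
  set v₁ : Fin n → ℝ := fun i => ‖v‖⁻¹ * v i with hv₁
  have hv₁S : v₁ ∈ S := by
    rw [hmemS]
    have : v₁ = ‖v‖⁻¹ • v := by funext i; simp [hv₁, smul_eq_mul]
    rw [this, norm_smul, norm_inv, norm_norm, inv_mul_cancel₀ hvn.ne']
  have hq0v : q 0 v < 0 := by
    simp only [hq]
    have e : ∑ i, (v i * ∑ j, H i j * v j + ((0 : ℝ) ^ 2 * M i + 0 * D i) * v i ^ 2)
        = ∑ i, v i * ∑ j, H i j * v j := Finset.sum_congr rfl fun i _ => by ring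
    rw [e]
    exact hv
  have hqv₁ : q 0 v₁ < 0 := by
    have h := quadPencil_smul M D H 0 ‖v‖⁻¹ v
    simp only [hq, hv₁] at h hq0v ⊢
    rw [h]
    exact mul_neg_of_pos_of_neg (by positivity) hq0v
  have hne : Nonempty (Fin n) := by
    by_contra h
    rw [not_nonempty_iff] at h
    exact hv0 (Subsingleton.elim _ _)
  -- on the sphere: `|uᵀHu| ≤ B` and `Σ uᵢ² ≥ 1`
  set B : ℝ := ∑ i, ∑ j, |H i j| with hB
  have hB0 : 0 ≤ B := Finset.sum_nonneg fun i _ => Finset.sum_nonneg fun j _ => abs_nonneg _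
  have hcoord : ∀ u ∈ S, ∀ i, |u i| ≤ 1 := by
    intro u hu i
    have h := norm_le_pi_norm u i
    rw [(hmemS u).1 hu, Real.norm_eq_abs] at h
    exact h
  have hHB : ∀ u ∈ S, -B ≤ ∑ i, u i * ∑ j, H i j * u j := by
    intro u hu
    have h1 : |∑ i, u i * ∑ j, H i j * u j| ≤ B := by
      rw [hB]
      refine (Finset.abs_sum_le_sum_abs _ _).trans (Finset.sum_le_sum fun i _ => ?_)
      rw [Finset.mul_sum]
      refine (Finset.abs_sum_le_sum_abs _ _).trans (Finset.sum_le_sum fun j _ => ?_)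
      rw [abs_mul, abs_mul]
      have hi := hcoord u hu i
      have hj := hcoord u hu j
      have h0 : 0 ≤ |H i j| := abs_nonneg _
      calc |u i| * (|H i j| * |u j|) ≤ 1 * (|H i j| * 1) := by
            apply mul_le_mul hi _ (by positivity) zero_le_one
            exact mul_le_mul_of_nonneg_left hj h0
        _ = |H i j| := by ring
    have := neg_abs_le (∑ i, u i * ∑ j, H i j * u j)
    linarith
  have hsq : ∀ u ∈ S, 1 ≤ ∑ i, u i ^ 2 := by
    intro u hu
    -- some coordinate has absolute value `1`
    have h1 : ∃ i, 1 ≤ |u i| := by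
      by_contra h
      push Not at h
      have h2 : ‖u‖ < 1 := by
        rw [pi_norm_lt_iff zero_lt_one]
        intro i
        rw [Real.norm_eq_abs]
        exact h i
      rw [(hmemS u).1 hu] at h2
      exact lt_irrefl _ h2
    obtain ⟨i, hi⟩ := h1
    have h3 : 1 ≤ u i ^ 2 := by
      have := hcoord u hu i
      have h4 : |u i| = 1 := le_antisymm this hi
      have h5 : u i ^ 2 = |u i| ^ 2 := (sq_abs _).symm
      rw [h5, h4]
      norm_num
    exact h3.trans (Finset.single_le_sum (fun j _ => sq_nonneg (u j)) (Finset.mem_univ i))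
  -- the smallest inertia and the cutoff `λ₀`
  obtain ⟨i₀, -, hi₀⟩ := Finset.exists_min_image Finset.univ M Finset.univ_nonempty
  set m := M i₀ with hm
  have hm0 : 0 < m := hM i₀
  have hmle : ∀ i, m ≤ M i := fun i => hi₀ i (Finset.mem_univ i)
  set lam₀ : ℝ := max 1 ((B + 1) / m) with hlam₀
  have hlam₀1 : 1 ≤ lam₀ := le_max_left _ _
  have hlam₀0 : 0 ≤ lam₀ := by linarith
  have hpos_lam₀ : ∀ u ∈ S, 0 < q lam₀ u := by
    intro u hu
    have h1 : lam₀ ^ 2 * m ≤ ∑ i, (lam₀ ^ 2 * M i + lam₀ * D i) * u i ^ 2 := by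
      calc lam₀ ^ 2 * m = lam₀ ^ 2 * m * 1 := by ring
        _ ≤ lam₀ ^ 2 * m * ∑ i, u i ^ 2 := by
            apply mul_le_mul_of_nonneg_left (hsq u hu); positivity
        _ = ∑ i, lam₀ ^ 2 * m * u i ^ 2 := by rw [Finset.mul_sum]
        _ ≤ _ := Finset.sum_le_sum fun i _ => by
            have h5 : lam₀ ^ 2 * m ≤ lam₀ ^ 2 * M i + lam₀ * D i := by
              have h6 : 0 ≤ lam₀ ^ 2 * (M i - m) := mul_nonneg (sq_nonneg _) (sub_nonneg.2 (hmle i))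
              have h7 : 0 ≤ lam₀ * D i := mul_nonneg hlam₀0 (hD i)
              nlinarith
            exact mul_le_mul_of_nonneg_right h5 (sq_nonneg _)
    have h2 : B + 1 ≤ lam₀ ^ 2 * m := by
      have h3 : (B + 1) / m ≤ lam₀ := le_max_right _ _
      rw [div_le_iff₀ hm0] at h3
      nlinarith
    have h3 := hHB u hu
    have h4 : q lam₀ u = (∑ i, u i * ∑ j, H i j * u j)
        + ∑ i, (lam₀ ^ 2 * M i + lam₀ * D i) * u i ^ 2 := by
      simp only [hq]
      rw [Finset.sum_add_distrib]
    rw [h4]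
    linarith
  -- the admissible set `Λ = {λ ∈ [0, λ₀] : q_λ ≤ 0 somewhere on the sphere}` is compact, nonempty
  set K : Set (ℝ × (Fin n → ℝ)) :=
    (Set.Icc 0 lam₀ ×ˢ S) ∩ {p | q p.1 p.2 ≤ 0} with hK
  have hKc : IsCompact K :=
    (isCompact_Icc.prod hScpt).inter_right (isClosed_le hqc continuous_const)
  set Λ : Set ℝ := Prod.fst '' K with hΛ
  have hΛc : IsCompact Λ := hKc.image continuous_fst
  have hmemΛ : ∀ l, l ∈ Λ ↔ l ∈ Set.Icc 0 lam₀ ∧ ∃ u ∈ S, q l u ≤ 0 := by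
    intro l
    constructor
    · rintro ⟨⟨l', u⟩, ⟨⟨hl', hu⟩, hq'⟩, rfl⟩
      exact ⟨hl', u, hu, hq'⟩
    · rintro ⟨hl, u, hu, hq'⟩
      exact ⟨(l, u), ⟨⟨hl, hu⟩, hq'⟩, rfl⟩
  have h0Λ : (0 : ℝ) ∈ Λ := (hmemΛ 0).2 ⟨⟨le_rfl, hlam₀0⟩, v₁, hv₁S, hqv₁.le⟩
  have hΛne : Λ.Nonempty := ⟨0, h0Λ⟩
  have hΛbdd : BddAbove Λ := hΛc.bddAbove
  set lamS := sSup Λ with hlamS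
  have hlamSmem : lamS ∈ Λ := hΛc.sSup_mem hΛne
  obtain ⟨⟨hlamS0, hlamSle⟩, uS, huS, hquS⟩ := (hmemΛ lamS).1 hlamSmem
  -- `λ* < λ₀`
  have hlamSlt : lamS < lam₀ := by
    rcases lt_or_eq_of_le hlamSle with h | h
    · exact h
    · exfalso
      have := hpos_lam₀ uS huS
      rw [← h] at this
      linarith
  -- `q_{λ*}` is nonnegative on the sphere (else a slightly larger `λ` would still be admissible)
  have hpsdS : ∀ z ∈ S, 0 ≤ q lamS z := by
    intro z hz
    by_contra hneg
    push Not at hneg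
    have hcz : Continuous fun l : ℝ => q l z :=
      hqc.comp (continuous_id.prodMk continuous_const)
    have hev : ∀ᶠ l in 𝓝 lamS, q l z < 0 := hcz.continuousAt.eventually_lt continuousAt_const hneg
    obtain ⟨η, hη, hball⟩ := Metric.eventually_nhds_iff.1 hev
    set l := min lam₀ (lamS + η / 2) with hl
    have hl1 : lamS < l := lt_min hlamSlt (by linarith)
    have hl2 : l ≤ lam₀ := min_le_left _ _
    have hl3 : dist l lamS < η := by
      rw [Real.dist_eq, abs_of_pos (by linarith)]
      have : l ≤ lamS + η / 2 := min_le_right _ _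
      linarith
    have hql : q l z < 0 := hball hl3
    have hlΛ : l ∈ Λ := (hmemΛ l).2 ⟨⟨by linarith, hl2⟩, z, hz, hql.le⟩
    have := le_csSup hΛbdd hlΛ
    linarith
  -- hence nonnegative everywhere (homogeneity)
  have hpsd : ∀ z : Fin n → ℝ, 0 ≤ q lamS z := by
    intro z
    by_cases hz : z = 0
    · simp [hq, hz]
    · have hzn : 0 < ‖z‖ := norm_pos_iff.2 hz
      set z₁ : Fin n → ℝ := fun i => ‖z‖⁻¹ * z i with hz₁
      have hz₁S : z₁ ∈ S := by
        rw [hmemS]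
        have : z₁ = ‖z‖⁻¹ • z := by funext i; simp [hz₁, smul_eq_mul]
        rw [this, norm_smul, norm_inv, norm_norm, inv_mul_cancel₀ hzn.ne']
      have h1 := hpsdS z₁ hz₁S
      have h2 : z = fun i => ‖z‖ * z₁ i := by
        funext i; simp only [hz₁]; field_simp
      have h3 := quadPencil_smul M D H lamS ‖z‖ z₁
      rw [h2]
      simp only [hq] at h1 h3 ⊢
      rw [h3]
      exact mul_nonneg (by positivity) h1
  -- `q_{λ*}(u*) = 0`, so `u*` is in the kernel of the pencil at `λ*`
  have hq0 : q lamS uS = 0 := le_antisymm hquS (hpsd uS)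
  have hker : ∀ w : Fin n → ℝ,
      ∑ i, w i * ((∑ j, H i j * uS j) + (lamS ^ 2 * M i + lamS * D i) * uS i) = 0 := by
    intro w
    refine eq_zero_of_forall_quad_nonneg (γ := q lamS w) fun t => ?_
    have h1 := hpsd (fun i => uS i + t * w i)
    have h2 := quadPencil_add_smul M D H hH lamS t uS w
    simp only [hq] at h1 h2 hq0 ⊢
    rw [h2, hq0] at h1
    linarith
  have huS0 : uS ≠ 0 := by
    intro h
    rw [hmemS, h, norm_zero] at huS
    exact zero_ne_one huS
  -- `λ* > 0`: at `λ = 0` the form is negative at `v₁`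
  have hlamSpos : 0 < lamS := by
    rcases lt_or_eq_of_le hlamS0 with h | h
    · exact h
    · exfalso
      have := hpsd v₁
      rw [← h] at this
      linarith
  refine ⟨lamS, hlamSpos, uS, huS0, fun i => ?_⟩
  have h := hker (fun k => if k = i then 1 else 0)
  simp only [ite_mul, one_mul, zero_mul, Finset.sum_ite_eq', Finset.mem_univ, if_true] at h
  linarith

end Pencil

/-! ### §2. The Jacobian of the swing field, its growing eigenvector, and Lemma 1's unstable clause -/

namespace LosslessSystem

section AnyBus

variable {n m : ℕ} (S : LosslessSystem n m)

/-- **The Jacobian of the swing field** `(θ, ω) ↦ (ω, M⁻¹(P − Dω − flow(θ)))` at `(θ₀, ω₀)`: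
`(δθ, δω) ↦ (δω, M⁻¹(−Hess(θ₀)δθ − Dδω))` (`hasFDerivAt_flowMap`: `D flow = Hess`).
[cite: ManikTimmeWitthaut2017, §3 (linearisation around a fixed point, the Hesse matrix M) and App. A] -/
theorem hasFDerivAt_field (x₀ : (Fin n → ℝ) × (Fin n → ℝ)) :
    HasFDerivAt S.field
      ((ContinuousLinearMap.snd ℝ (Fin n → ℝ) (Fin n → ℝ)).prod
        (ContinuousLinearMap.pi fun i : Fin n =>
          (S.M i)⁻¹ • (-((S.D i) • ((ContinuousLinearMap.proj i).comp
              (ContinuousLinearMap.snd ℝ (Fin n → ℝ) (Fin n → ℝ))))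
            - (ContinuousLinearMap.proj i).comp
              ((LinearMap.toContinuousLinearMap (Matrix.toLin' (S.hessMatrix x₀.1))).comp
                (ContinuousLinearMap.fst ℝ (Fin n → ℝ) (Fin n → ℝ))))))
      x₀ := by
  have hflow : HasFDerivAt (fun x : (Fin n → ℝ) × (Fin n → ℝ) => fun j => S.flow x.1 j)
      ((LinearMap.toContinuousLinearMap (Matrix.toLin' (S.hessMatrix x₀.1))).comp
        (ContinuousLinearMap.fst ℝ (Fin n → ℝ) (Fin n → ℝ))) x₀ :=
    (S.hasFDerivAt_flowMap x₀.1).comp x₀ hasFDerivAt_fst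
  have hsnd : HasFDerivAt (fun x : (Fin n → ℝ) × (Fin n → ℝ) => x.2)
      (ContinuousLinearMap.snd ℝ (Fin n → ℝ) (Fin n → ℝ)) x₀ := hasFDerivAt_snd
  have h2 : HasFDerivAt
      (fun x : (Fin n → ℝ) × (Fin n → ℝ) => fun i => (S.P i - S.D i * x.2 i - S.flow x.1 i) / S.M i)
      (ContinuousLinearMap.pi fun i : Fin n =>
          (S.M i)⁻¹ • (-((S.D i) • ((ContinuousLinearMap.proj i).comp
              (ContinuousLinearMap.snd ℝ (Fin n → ℝ) (Fin n → ℝ))))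
            - (ContinuousLinearMap.proj i).comp
              ((LinearMap.toContinuousLinearMap (Matrix.toLin' (S.hessMatrix x₀.1))).comp
                (ContinuousLinearMap.fst ℝ (Fin n → ℝ) (Fin n → ℝ))))) x₀ := by
    rw [hasFDerivAt_pi]
    intro i
    have hsi : HasFDerivAt (fun x : (Fin n → ℝ) × (Fin n → ℝ) => x.2 i)
        ((ContinuousLinearMap.proj i).comp (ContinuousLinearMap.snd ℝ (Fin n → ℝ) (Fin n → ℝ))) x₀ :=
      hasFDerivAt_pi'.1 hsnd i
    have hfi : HasFDerivAt (fun x : (Fin n → ℝ) × (Fin n → ℝ) => S.flow x.1 i)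
        ((ContinuousLinearMap.proj i).comp
          ((LinearMap.toContinuousLinearMap (Matrix.toLin' (S.hessMatrix x₀.1))).comp
            (ContinuousLinearMap.fst ℝ (Fin n → ℝ) (Fin n → ℝ)))) x₀ :=
      hasFDerivAt_pi'.1 hflow i
    have h3 : HasFDerivAt (fun x : (Fin n → ℝ) × (Fin n → ℝ) => S.P i - S.D i * x.2 i - S.flow x.1 i)
        (-((S.D i) • ((ContinuousLinearMap.proj i).comp
              (ContinuousLinearMap.snd ℝ (Fin n → ℝ) (Fin n → ℝ))))
          - (ContinuousLinearMap.proj i).comp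
              ((LinearMap.toContinuousLinearMap (Matrix.toLin' (S.hessMatrix x₀.1))).comp
                (ContinuousLinearMap.fst ℝ (Fin n → ℝ) (Fin n → ℝ)))) x₀ := by
      have h4 := ((hasFDerivAt_const (S.P i) x₀).sub (hsi.const_mul (S.D i))).sub hfi
      have e4 : ((fun _ : (Fin n → ℝ) × (Fin n → ℝ) => S.P i)
          - (fun y : (Fin n → ℝ) × (Fin n → ℝ) => S.D i * y.2 i))
          - (fun x : (Fin n → ℝ) × (Fin n → ℝ) => S.flow x.1 i)
          = fun x : (Fin n → ℝ) × (Fin n → ℝ) => S.P i - S.D i * x.2 i - S.flow x.1 i := by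
        funext x; simp only [Pi.sub_apply]
      rw [e4, zero_sub] at h4
      exact h4
    have h5 := h3.mul_const ((S.M i)⁻¹)
    have e : (fun x : (Fin n → ℝ) × (Fin n → ℝ) => (S.P i - S.D i * x.2 i - S.flow x.1 i) / S.M i)
        = fun x => (S.P i - S.D i * x.2 i - S.flow x.1 i) * (S.M i)⁻¹ :=
      funext fun x => div_eq_mul_inv _ _
    rw [e]
    exact h5
  exact hsnd.prodMk h2

/-- ★★ **LEMMA 1, UNSTABLE CLAUSE — no isolation, no census, no nondegeneracy** (any number of
infinite buses; `Mᵢ, Dᵢ > 0`, `C` symmetric). If `θe` solves the power-balance equations and ONE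
direction `v` has negative Hesse form
`½ΣᵢΣⱼ Cᵢⱼcos(θeᵢ − θeⱼ)(vᵢ − vⱼ)² + ΣᵢΣ_b Kᵢb cos(θeᵢ − β_b)vᵢ² < 0`, then the rest point `(θe, 0)` of
the damped swing model is UNSTABLE: there is `ε > 0` such that for every `δ > 0` some state `x₁` with
`dist(x₁, (θe, 0)) < δ` has ALL its forward motions leave the `ε`-ball around `(θe, 0)`. PROOF: the
negative direction gives a positive root `λ` of the pencil (`exists_pos_pencil_root_of_negativeDirection`),
`(u, λu)` is a real eigenvector of the Jacobian with eigenvalue `λ > 0`, and Lyapunov's indirect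
method (Khalil Thm 4.7 part 2, `unstable_of_charpoly_root_re_pos`) concludes — «It is unstable if at
least one eigenvalue of M is negative».
[cite: ManikTimmeWitthaut2017, §3 Lemma 1 (p0004 L46–L55); Khalil2002, Theorem 4.7 (part 2)] -/
theorem unstable_rest_of_hessForm_neg (hC : ∀ i j, S.C i j = S.C j i) (hM : ∀ i, 0 < S.M i)
    (hD : ∀ i, 0 < S.D i) {θe : Fin n → ℝ} (he : S.IsEquilibrium θe) (v : Fin n → ℝ)
    (hv : 1 / 2 * ∑ i, ∑ j, S.C i j * Real.cos (θe i - θe j) * (v i - v j) ^ 2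
        + ∑ i, ∑ b, S.K i b * Real.cos (θe i - S.β b) * v i ^ 2 < 0) :
    ∃ ε > 0, ∀ δ > 0, ∃ x₁ : (Fin n → ℝ) × (Fin n → ℝ), dist x₁ (θe, 0) < δ ∧
      ∀ X : ℝ → (Fin n → ℝ) × (Fin n → ℝ), X 0 = x₁ →
        (∀ T : ℝ, ∀ t ∈ Icc 0 T, HasDerivWithinAt X (S.field (X t)) (Icc 0 T) t) →
        ∃ t, 0 ≤ t ∧ ε < dist (X t) (θe, 0) := by
  -- the Hesse matrix is symmetric and represents the Hesse form
  set H := S.hessMatrix θe with hH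
  have hHs : ∀ i j, H i j = H j i := by
    intro i j
    simp only [hH, hessMatrix]
    by_cases hij : i = j
    · subst hij; rfl
    · rw [if_neg hij, if_neg (Ne.symm hij), hC i j, ← Real.cos_neg, neg_sub]
  have hvH : ∑ i, v i * ∑ j, H i j * v j < 0 := by
    have h1 := S.dotProduct_hessMatrix_mulVec hC θe v
    have h2 : v ⬝ᵥ (H *ᵥ v) = ∑ i, v i * ∑ j, H i j * v j := by
      simp only [dotProduct, Matrix.mulVec]
    rw [← h2, h1]
    exact hv
  -- the growing mode of the linearisation
  obtain ⟨lam, hlam, u, hu0, hu⟩ :=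
    exists_pos_pencil_root_of_negativeDirection S.M S.D hM (fun i => (hD i).le) H hHs v hvH
  -- the Jacobian and its real eigenvector `(u, λu)`
  set x₀ : (Fin n → ℝ) × (Fin n → ℝ) := (θe, 0) with hx₀
  set J := (ContinuousLinearMap.snd ℝ (Fin n → ℝ) (Fin n → ℝ)).prod
        (ContinuousLinearMap.pi fun i : Fin n =>
          (S.M i)⁻¹ • (-((S.D i) • ((ContinuousLinearMap.proj i).comp
              (ContinuousLinearMap.snd ℝ (Fin n → ℝ) (Fin n → ℝ))))
            - (ContinuousLinearMap.proj i).comp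
              ((LinearMap.toContinuousLinearMap (Matrix.toLin' (S.hessMatrix x₀.1))).comp
                (ContinuousLinearMap.fst ℝ (Fin n → ℝ) (Fin n → ℝ))))) with hJ
  have hfd : HasFDerivAt S.field J x₀ := S.hasFDerivAt_field x₀
  have hf0 : S.field x₀ = 0 := by
    simp only [hx₀, field]
    refine Prod.ext rfl (funext fun i => ?_)
    simp only [Pi.zero_apply, mul_zero, sub_zero, Prod.snd_zero]
    rw [← he i, sub_self, zero_div]
  set x : (Fin n → ℝ) × (Fin n → ℝ) := (u, fun i => lam * u i) with hx
  have hx0 : x ≠ 0 := by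
    intro h
    apply hu0
    have := congrArg Prod.fst h
    simpa [hx] using this
  have hJx : (J : (Fin n → ℝ) × (Fin n → ℝ) →ₗ[ℝ] (Fin n → ℝ) × (Fin n → ℝ)) x = lam • x := by
    rw [ContinuousLinearMap.coe_coe]
    simp only [hJ, hx, hx₀]
    refine Prod.ext ?_ ?_
    · simp only [ContinuousLinearMap.prod_apply, ContinuousLinearMap.coe_snd', Prod.smul_fst]
      funext i
      simp [smul_eq_mul]
    · simp only [ContinuousLinearMap.prod_apply, Prod.smul_snd]
      funext i
      simp only [ContinuousLinearMap.pi_apply, FunLike.coe_smul,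
        FunLike.coe_sub, FunLike.coe_neg, Pi.sub_apply, Pi.neg_apply,
        ContinuousLinearMap.comp_apply, ContinuousLinearMap.proj_apply,
        ContinuousLinearMap.coe_snd', ContinuousLinearMap.coe_fst',
        LinearMap.coe_toContinuousLinearMap', Matrix.toLin'_apply, Pi.smul_apply, smul_eq_mul]
      have h1 := hu i
      have h2 : (H *ᵥ u) i = ∑ j, H i j * u j := by simp only [Matrix.mulVec, dotProduct]
      have hMi := (hM i).ne'
      rw [hH] at h2
      rw [h2]
      field_simp
      linarith
  -- a real positive root of the characteristic polynomial
  have hroot : ∃ μ : ℂ, (((J : (Fin n → ℝ) × (Fin n → ℝ) →ₗ[ℝ] (Fin n → ℝ) × (Fin n → ℝ)).charpoly.map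
      (algebraMap ℝ ℂ)).IsRoot μ) ∧ 0 < μ.re := by
    refine ⟨algebraMap ℝ ℂ lam, ?_, by simpa using hlam⟩
    apply Polynomial.IsRoot.map
    rw [← Module.End.hasEigenvalue_iff_isRoot_charpoly]
    exact Module.End.hasEigenvalue_of_hasEigenvector ⟨Module.End.mem_eigenspace_iff.2 hJx, hx0⟩
  -- Lyapunov's indirect method, instability half
  obtain ⟨ε, hε, hall⟩ := Literature.Analysis.ODE.unstable_of_charpoly_root_re_pos hfd hf0 hroot
  refine ⟨ε, hε, fun δ hδ => ?_⟩
  obtain ⟨x₁, hx₁, hesc⟩ := hall δ hδ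
  refine ⟨x₁, by rwa [dist_eq_norm], fun X hX0 hX => ?_⟩
  obtain ⟨t, ht, hdist⟩ := hesc X hX hX0
  exact ⟨t, ht, by rwa [dist_eq_norm]⟩

end AnyBus

/-! ### §3. No infinite bus: the synchronous SOLUTION through a synchronous state with a negative
Hesse direction is unstable (rotating frame) -/

section NoBus

variable {n : ℕ} (S : LosslessSystem n 0)

/-- ★★ **LEMMA 1, UNSTABLE CLAUSE, FOR THE SYNCHRONOUS SOLUTION** (no infinite bus; `Mᵢ, Dᵢ > 0`,
`C` symmetric; synchronous state `Pₖ − Dₖω_s = flowₖ(θe)`, `ω_s = ΣP/ΣD`): ONE direction `v` with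
`½ΣᵢΣⱼ Cᵢⱼcos(θeᵢ − θeⱼ)(vᵢ − vⱼ)² < 0` makes the synchronous solution `t ↦ (θe + ω_s t𝟙, ω_s𝟙)`
UNSTABLE: there is `ε > 0` such that for every `δ > 0` some state `x₁` with `dist(x₁, (θe, ω_s𝟙)) < δ`
has all its forward motions depart from the synchronous solution by more than `ε` at some time
(`unstable_rest_of_hessForm_neg` for the co-rotating system, `globalSolution_rotatingFrame`,
`dist_syncFrame_eq`). No isolation, census or nondegeneracy hypothesis.
[cite: ManikTimmeWitthaut2017, §3 Lemma 1; Khalil2002, Theorem 4.7 (part 2); DorflerBullo2012, arXiv:0910.5673 §4.1 (rotating frame)] -/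
theorem unstable_syncSolution_of_hessForm_neg (hC : ∀ i j, S.C i j = S.C j i)
    (hM : ∀ i, 0 < S.M i) (hD : ∀ i, 0 < S.D i) {θe : Fin n → ℝ}
    (he : ∀ k, S.P k - S.D k * ((∑ j, S.P j) / ∑ j, S.D j) = S.flow θe k) (v : Fin n → ℝ)
    (hv : 1 / 2 * ∑ i, ∑ j, S.C i j * Real.cos (θe i - θe j) * (v i - v j) ^ 2 < 0) :
    ∃ ε > 0, ∀ δ > 0, ∃ x₁ : (Fin n → ℝ) × (Fin n → ℝ),
      dist x₁ (θe, fun _ => (∑ j, S.P j) / ∑ j, S.D j) < δ ∧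
      ∀ X : ℝ → (Fin n → ℝ) × (Fin n → ℝ), X 0 = x₁ →
        (∀ T : ℝ, ∀ t ∈ Icc 0 T, HasDerivWithinAt X (S.field (X t)) (Icc 0 T) t) →
        ∃ t, 0 ≤ t ∧ ε < dist (X t)
          ((fun j => θe j + (∑ j, S.P j) / (∑ j, S.D j) * t), fun _ => (∑ j, S.P j) / ∑ j, S.D j) := by
  set c := (∑ j, S.P j) / ∑ j, S.D j with hc
  set Sc : LosslessSystem n 0 := { S with P := fun i => S.P i - S.D i * c } with hSc
  have hCc : ∀ i j, Sc.C i j = Sc.C j i := hC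
  have hec : Sc.IsEquilibrium θe := fun i => he i
  have hvc : 1 / 2 * ∑ i, ∑ j, Sc.C i j * Real.cos (θe i - θe j) * (v i - v j) ^ 2
      + ∑ i, ∑ b, Sc.K i b * Real.cos (θe i - Sc.β b) * v i ^ 2 < 0 := by
    simpa only [Finset.univ_eq_empty, Finset.sum_empty, Finset.sum_const_zero, add_zero] using hv
  obtain ⟨ε, hε, hall⟩ := Sc.unstable_rest_of_hessForm_neg hCc hM hD hec v hvc
  refine ⟨ε, hε, fun δ hδ => ?_⟩
  obtain ⟨y₁, hy₁, hesc⟩ := hall δ hδ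
  -- back to the frame of the data: start at `(y₁.1, y₁.2 + c𝟙)`
  refine ⟨(y₁.1, fun j => y₁.2 j + c), ?_, fun X hX0 hX => ?_⟩
  · have h := dist_syncFrame_eq ((y₁.1, fun j => y₁.2 j + c)) θe c 0
    simp only [mul_zero, sub_zero, add_sub_cancel_right, add_zero] at h
    have e : ((y₁.1, fun j => y₁.2 j) : (Fin n → ℝ) × (Fin n → ℝ)) = y₁ := rfl
    rw [e] at h
    rw [← h]
    exact hy₁
  · set Xc : ℝ → (Fin n → ℝ) × (Fin n → ℝ) :=
      fun s => ((fun j => (X s).1 j - c * s), (fun j => (X s).2 j - c)) with hXc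
    have hXc' : ∀ T : ℝ, ∀ t ∈ Icc 0 T, HasDerivWithinAt Xc (Sc.field (Xc t)) (Icc 0 T) t :=
      S.globalSolution_rotatingFrame c hX
    have hXc0 : Xc 0 = y₁ := by
      simp only [hXc, hX0, mul_zero, sub_zero, add_sub_cancel_right]
    obtain ⟨t, ht, hd⟩ := hesc Xc hXc0 hXc'
    refine ⟨t, ht, ?_⟩
    rw [← dist_syncFrame_eq (X t) θe c t]
    exact hd

end NoBus

/-! ### §4. The tree's conditional unstable clauses, now WITHOUT the nondegeneracy hypothesis -/

section CutCorollaries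

variable {n m : ℕ} (S : LosslessSystem n m)

/-- **Negative cut ⇒ unstable rest point** (any infinite buses; no isolation / nondegeneracy): if
for some machine set `A` the total linearised stiffness leaving `A` —
`Σ_{i∈A, j∉A} Cᵢⱼcos(θeᵢ − θeⱼ) + Σ_{i∈A} Σ_b Kᵢb cos(θeᵢ − β_b)` — is NEGATIVE at an equilibrium `θe`,
the rest point `(θe, 0)` is unstable (indicator of `A` as the negative direction, `hessForm_indicator`).
[cite: TaylorKuramoto2012, §2 Lemma 2.1 (arXiv:1109.4451 p0007–p0008: a stable state has no negative cut); ManikTimmeWitthaut2017, §3 Lemma 1] -/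
theorem unstable_rest_of_negative_cut (hC : ∀ i j, S.C i j = S.C j i) (hM : ∀ i, 0 < S.M i)
    (hD : ∀ i, 0 < S.D i) {θe : Fin n → ℝ} (he : S.IsEquilibrium θe) (A : Finset (Fin n))
    (hcut : ∑ i ∈ A, ∑ j ∈ Aᶜ, S.C i j * Real.cos (θe i - θe j)
      + ∑ i ∈ A, ∑ b, S.K i b * Real.cos (θe i - S.β b) < 0) :
    ∃ ε > 0, ∀ δ > 0, ∃ x₁ : (Fin n → ℝ) × (Fin n → ℝ), dist x₁ (θe, 0) < δ ∧
      ∀ X : ℝ → (Fin n → ℝ) × (Fin n → ℝ), X 0 = x₁ →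
        (∀ T : ℝ, ∀ t ∈ Icc 0 T, HasDerivWithinAt X (S.field (X t)) (Icc 0 T) t) →
        ∃ t, 0 ≤ t ∧ ε < dist (X t) (θe, 0) := by
  refine S.unstable_rest_of_hessForm_neg hC hM hD he (fun i => if i ∈ A then (1 : ℝ) else 0) ?_
  rw [S.hessForm_indicator hC θe A]
  exact hcut

end CutCorollaries

section NoBusCorollaries

variable {n : ℕ} (S : LosslessSystem n 0)

/-- **Negative cut ⇒ unstable synchronous solution** (no infinite bus; no isolation / nondegeneracy —
supersedes `unstable_syncSolution_of_negative_cut_of_nondegenerate`).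
[cite: TaylorKuramoto2012, §2 Lemma 2.1; ManikTimmeWitthaut2017, §3 Lemma 1; Khalil2002, Theorem 4.7 (part 2)] -/
theorem unstable_syncSolution_of_negative_cut (hC : ∀ i j, S.C i j = S.C j i)
    (hM : ∀ i, 0 < S.M i) (hD : ∀ i, 0 < S.D i) {θe : Fin n → ℝ}
    (he : ∀ k, S.P k - S.D k * ((∑ j, S.P j) / ∑ j, S.D j) = S.flow θe k) (A : Finset (Fin n))
    (hcut : ∑ i ∈ A, ∑ j ∈ Aᶜ, S.C i j * Real.cos (θe i - θe j) < 0) :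
    ∃ ε > 0, ∀ δ > 0, ∃ x₁ : (Fin n → ℝ) × (Fin n → ℝ),
      dist x₁ (θe, fun _ => (∑ j, S.P j) / ∑ j, S.D j) < δ ∧
      ∀ X : ℝ → (Fin n → ℝ) × (Fin n → ℝ), X 0 = x₁ →
        (∀ T : ℝ, ∀ t ∈ Icc 0 T, HasDerivWithinAt X (S.field (X t)) (Icc 0 T) t) →
        ∃ t, 0 ≤ t ∧ ε < dist (X t)
          ((fun j => θe j + (∑ j, S.P j) / (∑ j, S.D j) * t), fun _ => (∑ j, S.P j) / ∑ j, S.D j) := by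
  refine S.unstable_syncSolution_of_hessForm_neg hC hM hD he (fun i => if i ∈ A then (1 : ℝ) else 0) ?_
  rw [S.hessForm_indicator_noBus hC θe A]
  exact hcut

end NoBusCorollaries

end LosslessSystem

section RingCorollaries

variable {n : ℕ} (S : LosslessSystem (n + 1) 0) (Kv : Fin (n + 1) → ℝ)

/-- **Loaded ring: two negative-cosine lines ⇒ unstable synchronous solution, with NO nondegeneracy
hypothesis** (supersedes `loadedRing_unstable_syncSolution_of_two_negative_lines`): the arc between
the two lines is a negative cut. «If there were two lines with negative weights the grid would be
unstable». [cite: DelabaysColettaJacquod2016, §4.3 (arXiv:1512.04266 p0013 L19–L37, the n−1 bound via Taylor's lemma); TaylorKuramoto2012, §2 Lemma 2.1; ManikTimmeWitthaut2017, §3 Lemma 1] -/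
theorem loadedRing_unstable_syncSolution_of_two_negative_lines' (hn : 2 ≤ n) (hK : ∀ k, 0 < Kv k)
    (hC : ∀ i j, S.C i j = if j = finRotate (n + 1) i then Kv i
      else if i = finRotate (n + 1) j then Kv j else 0)
    (hM : ∀ i, 0 < S.M i) (hD : ∀ i, 0 < S.D i) {θe : Fin (n + 1) → ℝ}
    (he : ∀ k, S.P k - S.D k * ((∑ j, S.P j) / ∑ j, S.D j) = S.flow θe k)
    {k₁ k₂ : Fin (n + 1)} (hk : k₁ ≠ k₂)
    (h₁ : Real.cos (θe k₁ - θe (finRotate (n + 1) k₁)) < 0)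
    (h₂ : Real.cos (θe k₂ - θe (finRotate (n + 1) k₂)) < 0) :
    ∃ ε > 0, ∀ δ > 0, ∃ x₁ : (Fin (n + 1) → ℝ) × (Fin (n + 1) → ℝ),
      dist x₁ (θe, fun _ => (∑ j, S.P j) / ∑ j, S.D j) < δ ∧
      ∀ X : ℝ → (Fin (n + 1) → ℝ) × (Fin (n + 1) → ℝ), X 0 = x₁ →
        (∀ T : ℝ, ∀ t ∈ Icc 0 T, HasDerivWithinAt X (S.field (X t)) (Icc 0 T) t) →
        ∃ t, 0 ≤ t ∧ ε < dist (X t)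
          ((fun j => θe j + (∑ j, S.P j) / (∑ j, S.D j) * t), fun _ => (∑ j, S.P j) / ∑ j, S.D j) := by
  set A : Finset (Fin (n + 1)) := Finset.univ.filter
    (fun j => (j - finRotate (n + 1) k₁).val ≤ (k₂ - finRotate (n + 1) k₁).val) with hAdef
  have hA : ∀ j, j ∈ A ↔ (j - finRotate (n + 1) k₁).val ≤ (k₂ - finRotate (n + 1) k₁).val := by
    intro j
    rw [hAdef, Finset.mem_filter]
    simp
  have hCs := loadedRing_C_symm S Kv hn hC
  refine S.unstable_syncSolution_of_negative_cut hCs hM hD he A ?_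
  rw [← S.hessForm_indicator_noBus hCs θe A, loadedRing_hessForm_indicator_arc S Kv hn hC θe hk hA]
  have := mul_neg_of_pos_of_neg (hK k₁) h₁
  have := mul_neg_of_pos_of_neg (hK k₂) h₂
  linarith

variable (K : ℝ) (M D : Fin (n + 1) → ℝ)

/-- ★★★ **DCJ Thm 4.1 for EVERY ring size** (unloaded homogeneous ring `R_N`, `N = n + 1 ≥ 3`,
`K > 0`, `Mᵢ, Dᵢ > 0`): a synchronous state (`flowₖ(θe) = 0`) with ONE negative-cosine line is an
UNSTABLE rest point `(θe, 0)` of the damped swing model — no parity, zero-cosine or nondegeneracy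
hypothesis (at such a state all `|cos|` agree, `ringSystem_abs_cos_eq`, so no cosine vanishes; the
negative direction is `ringSystem_exists_negativeDirection_of_long_line`; then Lemma 1's unstable
clause `unstable_rest_of_hessForm_neg`). With `ring_normalOperation_census`: a synchronous state of
`R_N` off the set `|θᵢ − θⱼ| = π/2` is stable iff it is in normal operation iff it is a twisted state
with `4|q| < N` — «any stable solution has all angle differences in [−π/2, π/2]».
[cite: DelabaysColettaJacquod2016, §4.2 Thm 4.1 (arXiv:1512.04266 p0009 L101–p0010 L58); ManikTimmeWitthaut2017, §3 Lemma 1 and §5.4; Khalil2002, Theorem 4.7 (part 2)] -/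
theorem ringSystem_unstable_of_long_line (hn : 2 ≤ n) (hK : 0 < K) (hM : ∀ i, 0 < M i)
    (hD : ∀ i, 0 < D i) {θe : Fin (n + 1) → ℝ} (hθ : ∀ k, (ringSystem n K M D).flow θe k = 0)
    (hneg : ∃ k, Real.cos (θe k - θe (finRotate (n + 1) k)) < 0) :
    ∃ ε > 0, ∀ δ > 0, ∃ x₁ : (Fin (n + 1) → ℝ) × (Fin (n + 1) → ℝ),
      dist x₁ (θe, 0) < δ ∧
      ∀ X : ℝ → (Fin (n + 1) → ℝ) × (Fin (n + 1) → ℝ), X 0 = x₁ →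
        (∀ T : ℝ, ∀ t ∈ Icc 0 T,
          HasDerivWithinAt X ((ringSystem n K M D).field (X t)) (Icc 0 T) t) →
        ∃ t, 0 ≤ t ∧ ε < dist (X t) (θe, 0) := by
  -- no cosine vanishes: all `|cos|` agree and one is negative
  obtain ⟨k₀, hk₀⟩ := hneg
  have h0 : ∀ k, Real.cos (θe k - θe (finRotate (n + 1) k)) ≠ 0 := by
    intro k hk
    have h1 := ringSystem_abs_cos_eq K M D hn hK.ne' hθ k
    have h2 := ringSystem_abs_cos_eq K M D hn hK.ne' hθ k₀
    rw [hk, abs_zero] at h1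
    rw [← h1, abs_eq_zero] at h2
    exact hk₀.ne h2
  obtain ⟨v, hv⟩ := ringSystem_exists_negativeDirection_of_long_line K M D hn hK hθ h0 ⟨k₀, hk₀⟩
  have he : (ringSystem n K M D).IsEquilibrium θe := by
    intro k
    rw [hθ k]
    simp [ringSystem]
  refine (ringSystem n K M D).unstable_rest_of_hessForm_neg (ringSystem_C_symm K M D) hM hD he v ?_
  simpa only [Finset.univ_eq_empty, Finset.sum_empty, Finset.sum_const_zero, add_zero] using hv

end RingCorollaries

/-! ### §5. The unloaded homogeneous ring: «STABLE ⇔ NORMAL OPERATION ⇔ TWISTED WITH 4|q| < N», for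
every ring size (append 2026-08-28) -/

section RingDichotomy

variable {n : ℕ} (K : ℝ) (M D : Fin (n + 1) → ℝ)

/-- ★★★ **DCJ Thm 4.1 / MTW Thm 12 as ONE equivalence, every `N = n + 1 ≥ 3`** (`K > 0`,
`Mᵢ, Dᵢ > 0`; unloaded homogeneous ring). For a synchronous state `θ` (`flowₖ(θ) = 0`) with no line
at `|θₖ − θ_{ρk}| = π/2 (mod π)` the following are equivalent: (i) the rest point `(θ, 0)` of the
damped swing model is LYAPUNOV STABLE — for every `ε > 0` some `δ > 0` such that every initial state
`x₁` with `dist(x₁, (θ, 0)) < δ` HAS a forward-global motion and ALL its motions stay `ε`-close to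
`(θ, 0)` for all `t ≥ 0`; (ii) NORMAL OPERATION: `cos(θₖ − θ_{ρk}) > 0` on every line.
(ii) ⇒ (i) is `ring_normalOperation_stable` (energy route, Cor. 1); (i) ⇒ (ii): otherwise some line
has a negative cosine and `ringSystem_unstable_of_long_line` produces, for every `δ`, a `δ`-close
state all of whose motions leave a fixed ball — one of them exists by (i). «Any stable solution has
all angle differences in [−π/2, π/2]» and conversely.
[cite: DelabaysColettaJacquod2016, §4.2 Thm 4.1 (arXiv:1512.04266 p0009 L101–p0010 L58); ManikTimmeWitthaut2017, §3 Lemma 1 with Cor. 1 and §5.4 Thm 12; Khalil2002, Theorem 4.7 (part 2)] -/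
theorem ringSystem_stable_iff_normalOperation (hn : 2 ≤ n) (hK : 0 < K) (hM : ∀ i, 0 < M i)
    (hD : ∀ i, 0 < D i) {θ : Fin (n + 1) → ℝ} (hflow : ∀ k, (ringSystem n K M D).flow θ k = 0)
    (h0 : ∀ k, Real.cos (θ k - θ (finRotate (n + 1) k)) ≠ 0) :
    (∀ ε > 0, ∃ δ > 0, ∀ x₁ : (Fin (n + 1) → ℝ) × (Fin (n + 1) → ℝ), dist x₁ (θ, 0) < δ →
      (∃ X : ℝ → (Fin (n + 1) → ℝ) × (Fin (n + 1) → ℝ), X 0 = x₁ ∧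
          ∀ T : ℝ, ∀ t ∈ Icc 0 T,
            HasDerivWithinAt X ((ringSystem n K M D).field (X t)) (Icc 0 T) t) ∧
        ∀ X : ℝ → (Fin (n + 1) → ℝ) × (Fin (n + 1) → ℝ), X 0 = x₁ →
          (∀ T : ℝ, ∀ t ∈ Icc 0 T,
            HasDerivWithinAt X ((ringSystem n K M D).field (X t)) (Icc 0 T) t) →
          ∀ t, 0 ≤ t → dist (X t) (θ, 0) < ε)
    ↔ ∀ k, 0 < Real.cos (θ k - θ (finRotate (n + 1) k)) := by
  constructor
  · intro hst
    by_contra hno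
    push Not at hno
    obtain ⟨k, hk⟩ := hno
    have hneg : Real.cos (θ k - θ (finRotate (n + 1) k)) < 0 := lt_of_le_of_ne hk (h0 k)
    obtain ⟨ε, hε, hall⟩ := ringSystem_unstable_of_long_line K M D hn hK hM hD hflow ⟨k, hneg⟩
    obtain ⟨δ, hδ, hstay⟩ := hst ε hε
    obtain ⟨x₁, hx₁, hesc⟩ := hall δ hδ
    obtain ⟨⟨X, hX0, hX⟩, hst'⟩ := hstay x₁ hx₁
    obtain ⟨t, ht, hfar⟩ := hesc X hX0 hX
    have := hst' X hX0 hX t ht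
    linarith
  · intro hno ε hε
    obtain ⟨δ, hδ, h⟩ := ring_normalOperation_stable K M D hn hK hM hD hflow hno hε
    refine ⟨δ, hδ, fun x₁ hx₁ => ⟨(h x₁ hx₁).1, fun X hX0 hX => ((h x₁ hx₁).2 X hX0 hX).1⟩⟩

/-- ★★★ **… ⇔ TWISTED WITH `4|q| < N`**: under the same hypotheses the rest point `(θ, 0)` is
Lyapunov stable iff `θ` is, up to a common rotation and whole turns of single machines, a twisted
state `θ_q` (`θⱼ = 2πqj/N`) with winding number `4|q| < N` (`exists_winding_of_normalOperation`,
`cos_twisted_edge`, `cos_twisted_pos`). With `ring_normalOperation_census` these are exactly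
`2·⌊n/4⌋ + 1 = 2⌈N/4⌉ − 1` states per period and rotation.
[cite: DelabaysColettaJacquod2016, §4.2 Thm 4.1 with eq. (4.4) («Δ ∈ {2πq/n}»); ManikTimmeWitthaut2017, §5.4 Thm 12 and Cor. 4] -/
theorem ringSystem_stable_iff_twisted (hn : 2 ≤ n) (hK : 0 < K) (hM : ∀ i, 0 < M i)
    (hD : ∀ i, 0 < D i) {θ : Fin (n + 1) → ℝ} (hflow : ∀ k, (ringSystem n K M D).flow θ k = 0)
    (h0 : ∀ k, Real.cos (θ k - θ (finRotate (n + 1) k)) ≠ 0) :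
    (∀ ε > 0, ∃ δ > 0, ∀ x₁ : (Fin (n + 1) → ℝ) × (Fin (n + 1) → ℝ), dist x₁ (θ, 0) < δ →
      (∃ X : ℝ → (Fin (n + 1) → ℝ) × (Fin (n + 1) → ℝ), X 0 = x₁ ∧
          ∀ T : ℝ, ∀ t ∈ Icc 0 T,
            HasDerivWithinAt X ((ringSystem n K M D).field (X t)) (Icc 0 T) t) ∧
        ∀ X : ℝ → (Fin (n + 1) → ℝ) × (Fin (n + 1) → ℝ), X 0 = x₁ →
          (∀ T : ℝ, ∀ t ∈ Icc 0 T,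
            HasDerivWithinAt X ((ringSystem n K M D).field (X t)) (Icc 0 T) t) →
          ∀ t, 0 ≤ t → dist (X t) (θ, 0) < ε)
    ↔ ∃ q : ℤ, 4 * |q| < (n : ℤ) + 1 ∧ ∀ j : Fin (n + 1), ∃ mj : ℤ,
        θ j = θ 0 + twistedState n q j + mj * (2 * π) := by
  rw [ringSystem_stable_iff_normalOperation K M D hn hK hM hD hflow h0]
  constructor
  · exact exists_winding_of_normalOperation K M D hn hK hflow
  · rintro ⟨q, hq, hθ⟩ k
    obtain ⟨mk, hmk⟩ := hθ k
    obtain ⟨mk', hmk'⟩ := hθ (finRotate (n + 1) k)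
    have e : θ k - θ (finRotate (n + 1) k)
        = (twistedState n q k - twistedState n q (finRotate (n + 1) k))
          + ((mk - mk' : ℤ) : ℝ) * (2 * π) := by
      rw [hmk, hmk']
      push_cast
      ring
    rw [e, Real.cos_add_int_mul_two_pi, cos_twisted_edge]
    exact cos_twisted_pos hq

end RingDichotomy

/-! ### §6. NECESSITY, as printed: a Lyapunov-stable equilibrium has a positive semidefinite Hesse
form; Taylor's cut lemma and DCJ's «at most one long line» with «stable» = Lyapunov stable
(append 2026-08-28; motions exist from every state, `exists_globalSolution`) -/

namespace LosslessSystem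

section Necessity

variable {n m : ℕ} (S : LosslessSystem n m)

/-- ★★ **LEMMA 1, NECESSITY: a STABLE equilibrium has a positive semidefinite Hesse form** (any
infinite buses; `Mᵢ, Dᵢ > 0`, `C` symmetric). If the rest point `(θe, 0)` is Lyapunov stable — for
every `ε > 0` some `δ > 0` such that every motion from every state `δ`-close to `(θe, 0)` stays
`ε`-close for all `t ≥ 0` — then `½ΣᵢΣⱼCᵢⱼcos(θeᵢ − θeⱼ)(vᵢ − vⱼ)² + ΣᵢΣ_bKᵢb cos(θeᵢ − β_b)vᵢ² ≥ 0`
for EVERY `v` (contrapositive of `unstable_rest_of_hessForm_neg`; the escaping state has a motion by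
`exists_globalSolution`). «The linear stability … is determined by the eigenvalues of the Hesse
matrix … unstable if at least one eigenvalue is negative.»
[cite: ManikTimmeWitthaut2017, §3 Lemma 1; TaylorKuramoto2012, §2 (a stable fixed point has positive semidefinite Hessian, arXiv:1109.4451 p0007); Khalil2002, Theorem 4.7 (part 2)] -/
theorem hessForm_nonneg_of_stable (hC : ∀ i j, S.C i j = S.C j i) (hM : ∀ i, 0 < S.M i)
    (hD : ∀ i, 0 < S.D i) {θe : Fin n → ℝ} (he : S.IsEquilibrium θe)
    (hst : ∀ ε > 0, ∃ δ > 0, ∀ x₁ : (Fin n → ℝ) × (Fin n → ℝ), dist x₁ (θe, 0) < δ →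
      ∀ X : ℝ → (Fin n → ℝ) × (Fin n → ℝ), X 0 = x₁ →
        (∀ T : ℝ, ∀ t ∈ Icc 0 T, HasDerivWithinAt X (S.field (X t)) (Icc 0 T) t) →
        ∀ t, 0 ≤ t → dist (X t) (θe, 0) < ε)
    (v : Fin n → ℝ) :
    0 ≤ 1 / 2 * ∑ i, ∑ j, S.C i j * Real.cos (θe i - θe j) * (v i - v j) ^ 2
        + ∑ i, ∑ b, S.K i b * Real.cos (θe i - S.β b) * v i ^ 2 := by
  by_contra hneg
  push Not at hneg
  obtain ⟨ε, hε, hall⟩ := S.unstable_rest_of_hessForm_neg hC hM hD he v hneg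
  obtain ⟨δ, hδ, hstay⟩ := hst ε hε
  obtain ⟨x₁, hx₁, hesc⟩ := hall δ hδ
  obtain ⟨X, hX0, hX⟩ := S.exists_globalSolution x₁
  obtain ⟨t, ht, hfar⟩ := hesc X hX0 hX
  have := hstay x₁ hx₁ X hX0 hX t ht
  linarith

/-- ★★ **TAYLOR'S CUT LEMMA AS PRINTED** (any infinite buses; `Mᵢ, Dᵢ > 0`, `C` symmetric): at a
Lyapunov-STABLE equilibrium every cut is non-negative —
`Σ_{i∈A, j∉A} Cᵢⱼcos(θeᵢ − θeⱼ) + Σ_{i∈A}Σ_b Kᵢb cos(θeᵢ − β_b) ≥ 0` for every machine set `A`. «Lemma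
2.1. Let θ be a stable fixed point … then for any cut C of the graph Σ_{(i,j)∈C} aᵢⱼcos(θᵢ − θⱼ) ≥ 0.»
[cite: TaylorKuramoto2012, §2 Lemma 2.1 (arXiv:1109.4451 p0007–p0008); ManikTimmeWitthaut2017, §3 Lemma 1] -/
theorem cut_nonneg_of_stable (hC : ∀ i j, S.C i j = S.C j i) (hM : ∀ i, 0 < S.M i)
    (hD : ∀ i, 0 < S.D i) {θe : Fin n → ℝ} (he : S.IsEquilibrium θe)
    (hst : ∀ ε > 0, ∃ δ > 0, ∀ x₁ : (Fin n → ℝ) × (Fin n → ℝ), dist x₁ (θe, 0) < δ →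
      ∀ X : ℝ → (Fin n → ℝ) × (Fin n → ℝ), X 0 = x₁ →
        (∀ T : ℝ, ∀ t ∈ Icc 0 T, HasDerivWithinAt X (S.field (X t)) (Icc 0 T) t) →
        ∀ t, 0 ≤ t → dist (X t) (θe, 0) < ε)
    (A : Finset (Fin n)) :
    0 ≤ ∑ i ∈ A, ∑ j ∈ Aᶜ, S.C i j * Real.cos (θe i - θe j)
      + ∑ i ∈ A, ∑ b, S.K i b * Real.cos (θe i - S.β b) :=
  S.cut_nonneg_of_hessForm_nonneg hC (S.hessForm_nonneg_of_stable hC hM hD he hst) A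

end Necessity

section NecessityNoBus

variable {n : ℕ} (S : LosslessSystem n 0)

/-- ★★ **Necessity for the synchronous solution** (no infinite bus; `Mᵢ, Dᵢ > 0`, `C` symmetric;
synchronous state `Pₖ − Dₖω_s = flowₖ(θe)`): if the synchronous solution `(θe + ω_s t𝟙, ω_s𝟙)` is
Lyapunov stable — every motion from every state `δ`-close to `(θe, ω_s𝟙)` stays `ε`-close to it —
then the Hesse form `½ΣᵢΣⱼCᵢⱼcos(θeᵢ − θeⱼ)(vᵢ − vⱼ)²` is non-negative in every direction.
[cite: ManikTimmeWitthaut2017, §3 Lemma 1; TaylorKuramoto2012, §2 Lemma 2.1; Khalil2002, Theorem 4.7 (part 2)] -/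
theorem hessForm_nonneg_of_stable_syncSolution (hC : ∀ i j, S.C i j = S.C j i)
    (hM : ∀ i, 0 < S.M i) (hD : ∀ i, 0 < S.D i) {θe : Fin n → ℝ}
    (he : ∀ k, S.P k - S.D k * ((∑ j, S.P j) / ∑ j, S.D j) = S.flow θe k)
    (hst : ∀ ε > 0, ∃ δ > 0, ∀ x₁ : (Fin n → ℝ) × (Fin n → ℝ),
      dist x₁ (θe, fun _ => (∑ j, S.P j) / ∑ j, S.D j) < δ →
      ∀ X : ℝ → (Fin n → ℝ) × (Fin n → ℝ), X 0 = x₁ →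
        (∀ T : ℝ, ∀ t ∈ Icc 0 T, HasDerivWithinAt X (S.field (X t)) (Icc 0 T) t) →
        ∀ t, 0 ≤ t → dist (X t)
          ((fun j => θe j + (∑ j, S.P j) / (∑ j, S.D j) * t), fun _ => (∑ j, S.P j) / ∑ j, S.D j)
            < ε)
    (v : Fin n → ℝ) :
    0 ≤ 1 / 2 * ∑ i, ∑ j, S.C i j * Real.cos (θe i - θe j) * (v i - v j) ^ 2 := by
  by_contra hneg
  push Not at hneg
  obtain ⟨ε, hε, hall⟩ := S.unstable_syncSolution_of_hessForm_neg hC hM hD he v hneg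
  obtain ⟨δ, hδ, hstay⟩ := hst ε hε
  obtain ⟨x₁, hx₁, hesc⟩ := hall δ hδ
  obtain ⟨X, hX0, hX⟩ := S.exists_globalSolution x₁
  obtain ⟨t, ht, hfar⟩ := hesc X hX0 hX
  have := hstay x₁ hx₁ X hX0 hX t ht
  linarith

/-- **Taylor's cut lemma for a stable synchronous solution** (no infinite bus): every cut is
non-negative, `Σ_{i∈A, j∉A} Cᵢⱼcos(θeᵢ − θeⱼ) ≥ 0`.
[cite: TaylorKuramoto2012, §2 Lemma 2.1; ManikTimmeWitthaut2017, §3 Lemma 1] -/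
theorem cut_nonneg_of_stable_syncSolution (hC : ∀ i j, S.C i j = S.C j i)
    (hM : ∀ i, 0 < S.M i) (hD : ∀ i, 0 < S.D i) {θe : Fin n → ℝ}
    (he : ∀ k, S.P k - S.D k * ((∑ j, S.P j) / ∑ j, S.D j) = S.flow θe k)
    (hst : ∀ ε > 0, ∃ δ > 0, ∀ x₁ : (Fin n → ℝ) × (Fin n → ℝ),
      dist x₁ (θe, fun _ => (∑ j, S.P j) / ∑ j, S.D j) < δ →
      ∀ X : ℝ → (Fin n → ℝ) × (Fin n → ℝ), X 0 = x₁ →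
        (∀ T : ℝ, ∀ t ∈ Icc 0 T, HasDerivWithinAt X (S.field (X t)) (Icc 0 T) t) →
        ∀ t, 0 ≤ t → dist (X t)
          ((fun j => θe j + (∑ j, S.P j) / (∑ j, S.D j) * t), fun _ => (∑ j, S.P j) / ∑ j, S.D j)
            < ε)
    (A : Finset (Fin n)) :
    0 ≤ ∑ i ∈ A, ∑ j ∈ Aᶜ, S.C i j * Real.cos (θe i - θe j) := by
  rw [← S.hessForm_indicator_noBus hC θe A]
  exact S.hessForm_nonneg_of_stable_syncSolution hC hM hD he hst _

end NecessityNoBus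

end LosslessSystem

section LoadedRingNecessity

variable {n : ℕ} (S : LosslessSystem (n + 1) 0) (Kv : Fin (n + 1) → ℝ)

/-- ★★ **DCJ §4.3 AS PRINTED: a STABLE synchronous solution of a loaded ring has AT MOST ONE line
with a negative cosine** (`N ≥ 3`, line susceptances `Kₖ > 0`, `Mᵢ, Dᵢ > 0`; «stable» = the
synchronous solution is Lyapunov stable): two distinct lines with `cos(θeₖ − θe_{ρk}) < 0` are
impossible (`loadedRing_unstable_syncSolution_of_two_negative_lines'` and existence of motions).
«If there were two lines with negative weights, the grid would be unstable» — hence a stable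
solution has `|Δₖ| > π/2` on at most one line.
[cite: DelabaysColettaJacquod2016, §4.3 (arXiv:1512.04266 p0013 L19–L37); TaylorKuramoto2012, §2 Lemma 2.1] -/
theorem loadedRing_at_most_one_negative_line_of_stable (hn : 2 ≤ n) (hK : ∀ k, 0 < Kv k)
    (hC : ∀ i j, S.C i j = if j = finRotate (n + 1) i then Kv i
      else if i = finRotate (n + 1) j then Kv j else 0)
    (hM : ∀ i, 0 < S.M i) (hD : ∀ i, 0 < S.D i) {θe : Fin (n + 1) → ℝ}
    (he : ∀ k, S.P k - S.D k * ((∑ j, S.P j) / ∑ j, S.D j) = S.flow θe k)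
    (hst : ∀ ε > 0, ∃ δ > 0, ∀ x₁ : (Fin (n + 1) → ℝ) × (Fin (n + 1) → ℝ),
      dist x₁ (θe, fun _ => (∑ j, S.P j) / ∑ j, S.D j) < δ →
      ∀ X : ℝ → (Fin (n + 1) → ℝ) × (Fin (n + 1) → ℝ), X 0 = x₁ →
        (∀ T : ℝ, ∀ t ∈ Icc 0 T, HasDerivWithinAt X (S.field (X t)) (Icc 0 T) t) →
        ∀ t, 0 ≤ t → dist (X t)
          ((fun j => θe j + (∑ j, S.P j) / (∑ j, S.D j) * t), fun _ => (∑ j, S.P j) / ∑ j, S.D j)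
            < ε)
    {k₁ k₂ : Fin (n + 1)} (h₁ : Real.cos (θe k₁ - θe (finRotate (n + 1) k₁)) < 0)
    (h₂ : Real.cos (θe k₂ - θe (finRotate (n + 1) k₂)) < 0) : k₁ = k₂ := by
  by_contra hk
  obtain ⟨ε, hε, hall⟩ :=
    loadedRing_unstable_syncSolution_of_two_negative_lines' S Kv hn hK hC hM hD he hk h₁ h₂
  obtain ⟨δ, hδ, hstay⟩ := hst ε hε
  obtain ⟨x₁, hx₁, hesc⟩ := hall δ hδ
  obtain ⟨X, hX0, hX⟩ := S.exists_globalSolution x₁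
  obtain ⟨t, ht, hfar⟩ := hesc X hX0 hX
  have := hstay x₁ hx₁ X hX0 hX t ht
  linarith

/-- **… so the lines with `|θₖ − θ_{ρk}| > π/2` (negative cosine) number at most one.**
[cite: DelabaysColettaJacquod2016, §4.3 (arXiv:1512.04266 p0013 L19–L37)] -/
theorem loadedRing_card_negative_lines_le_one_of_stable (hn : 2 ≤ n) (hK : ∀ k, 0 < Kv k)
    (hC : ∀ i j, S.C i j = if j = finRotate (n + 1) i then Kv i
      else if i = finRotate (n + 1) j then Kv j else 0)
    (hM : ∀ i, 0 < S.M i) (hD : ∀ i, 0 < S.D i) {θe : Fin (n + 1) → ℝ}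
    (he : ∀ k, S.P k - S.D k * ((∑ j, S.P j) / ∑ j, S.D j) = S.flow θe k)
    (hst : ∀ ε > 0, ∃ δ > 0, ∀ x₁ : (Fin (n + 1) → ℝ) × (Fin (n + 1) → ℝ),
      dist x₁ (θe, fun _ => (∑ j, S.P j) / ∑ j, S.D j) < δ →
      ∀ X : ℝ → (Fin (n + 1) → ℝ) × (Fin (n + 1) → ℝ), X 0 = x₁ →
        (∀ T : ℝ, ∀ t ∈ Icc 0 T, HasDerivWithinAt X (S.field (X t)) (Icc 0 T) t) →
        ∀ t, 0 ≤ t → dist (X t)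
          ((fun j => θe j + (∑ j, S.P j) / (∑ j, S.D j) * t), fun _ => (∑ j, S.P j) / ∑ j, S.D j)
            < ε) :
    (Finset.univ.filter
      (fun k : Fin (n + 1) => Real.cos (θe k - θe (finRotate (n + 1) k)) < 0)).card ≤ 1 := by
  rw [Finset.card_le_one]
  intro a ha b hb
  rw [Finset.mem_filter] at ha hb
  exact loadedRing_at_most_one_negative_line_of_stable S Kv hn hK hC hM hD he hst ha.2 hb.2

end LoadedRingNecessity

end ClassicalModel

end Literature.MathematicalPhysics.PowerSystems

end
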